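import Mathlib
import Literature.Probability.LatticeModels.ScalingLimit
import Literature.Barriers.CriticalPhenomena.ScaleCovarianceNotMoebius
import HarnessLib

/-!
# The barrier witness `narrowFamily` has no vertex measure

Stub `stub_narrowFamilyNoVertexMeasure` of line `Sketch` (card `amputated-lebowitz-vertex-measure`)
for the crux `MoebiusLimitOfTwoPointLaw` (item stmt-CriticalPhenomena-4801, thesis PrecisionLaplacian
of `Ising3DConformalLimit`): the line's evasion of the catalogued barrier D-0021.

The line represents the connected four-point function of every candidate limit with two-point
function `c‖x − y‖^{-2Δ}` as `U₄(x₁; x₂,x₃,x₄) = −∫ c‖x₁ − z‖^{-2Δ} dν_X(z)` with `ν_X` a finite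
positive measure (a "vertex measure"). The catalogued barrier
`Literature.Barriers.CriticalPhenomena.ScaleCovarianceNotMoebius` has the witness family
`ScaleNotMoebius.narrowFamily Δ` (Euclidean and scale covariant, two-point function `‖x − y‖^{-2Δ}`,
i.e. `c = 1`, all of the barrier's listed properties, not Möbius covariant). We prove that for
`0 < Δ` it admits NO vertex-measure representation, so the vertex-measure form of the line's
lattice input lies outside the barrier's technique class:

* its connected four-point function is `−bump`, `bump Δ x = (∑ᵢ ∑ⱼ ‖xᵢ − xⱼ‖²)^{-2Δ}`
  (`limitConnectedFour_narrowFamily`), and `bump ≤ twoPt(x₀,x₁)²` (`bump_le_twoPt_sq`), so along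
  the test configuration `(t e, e, 2e, 3e)` (`‖e‖ = 1`, `t > 3`) it is `≤ (t − 1)^{-4Δ}`;
* a vertex measure `ν` for the triple `(e, 2e, 3e)` would give
  `bump(t e, e, 2e, 3e) = ∫ ‖t e − z‖^{-2Δ} dν(z)`; `ν = 0` is excluded by `bump > 0` (`bump_pos`),
  and otherwise some ball `B_R` has positive mass `m`, whence the monopole lower bound
  `bump(t e, e, 2e, 3e) ≥ m (t + R)^{-2Δ} ≥ m 2^{-2Δ} t^{-2Δ}` for `t ≥ 2R + 4`;
* the two bounds are incompatible once `t^{2Δ} > 2^{6Δ} / m`.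

Ported from the ideator's kernel-checked sketch
`Cruxes/MoebiusLimitOfTwoPointLaw/SketchIdeator4R2.lean` (`narrowFamilyHasNoVertexMeasure`); only
Mathlib measure theory (`setIntegral_mono_on`, `setIntegral_le_integral`, `measure_iUnion_null`)
and the barrier file's `bump_pos`, `bump_le_twoPt_sq`, `limitConnectedFour_narrowFamily` are used.
-/

noncomputable section

namespace Summit.CriticalPhenomena.Ising3DConformalLimit.PrecisionLaplacianMoebiusLimitOfTwoPointLaw

open Literature.Probability.LatticeModels Filter Topology EuclideanGeometry MeasureTheory

section BarrierEvasion

open Literature.Barriers.CriticalPhenomena.ScaleNotMoebius Metric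

/-- Each point of the test configuration `(t e, e, 2e, 3e)` is a scalar multiple of `e`, with
scalars `(t, 1, 2, 3)`. [folklore] -/
private theorem nfv_cfg_apply (e : EuclideanSpace ℝ (Fin 3)) (t : ℝ) (i : Fin 4) :
    (![t • e, e, (2 : ℝ) • e, (3 : ℝ) • e] : Fin 4 → EuclideanSpace ℝ (Fin 3)) i =
      (![t, 1, 2, 3] : Fin 4 → ℝ) i • e := by
  fin_cases i <;> simp

/-- The scalars `(t, 1, 2, 3)` are pairwise distinct for `3 < t`. [folklore] -/
private theorem nfv_scal_injective {t : ℝ} (ht : 3 < t) :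
    Function.Injective (![t, 1, 2, 3] : Fin 4 → ℝ) := by
  intro i j h
  fin_cases i <;> fin_cases j <;> simp at h ⊢ <;> linarith

/-- The test configuration is non-coincident for `e ≠ 0` and `3 < t`. [folklore] -/
private theorem nfv_cfg_injective {e : EuclideanSpace ℝ (Fin 3)} (he : e ≠ 0) {t : ℝ}
    (ht : 3 < t) :
    Function.Injective (![t • e, e, (2 : ℝ) • e, (3 : ℝ) • e] : Fin 4 → EuclideanSpace ℝ (Fin 3)) := by
  intro i j h
  rw [nfv_cfg_apply, nfv_cfg_apply] at h
  exact nfv_scal_injective ht (smul_left_injective ℝ he h)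

/-- `‖t e‖ = t` for a unit vector `e` and `0 < t`. [folklore] -/
private theorem nfv_norm_smul {e : EuclideanSpace ℝ (Fin 3)} (he : ‖e‖ = 1) {t : ℝ} (ht : 0 < t) :
    ‖t • e‖ = t := by
  rw [norm_smul, he, mul_one, Real.norm_eq_abs, abs_of_pos ht]

/-- `bump ≤ (t − 1)^{-4Δ}` along the test configuration (one pair bound `bump ≤ twoPt(x₀,x₁)²`,
`‖t e − e‖ = t − 1`). [folklore] -/
private theorem nfv_bump_cfg_le {e : EuclideanSpace ℝ (Fin 3)} (he : ‖e‖ = 1) {Δ t : ℝ}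
    (hΔ : 0 < Δ) (ht : 3 < t) :
    bump Δ ![t • e, e, (2 : ℝ) • e, (3 : ℝ) • e] ≤ ((t - 1) ^ (-(2 * Δ))) ^ 2 := by
  set x : Fin 4 → EuclideanSpace ℝ (Fin 3) := ![t • e, e, (2 : ℝ) • e, (3 : ℝ) • e] with hx
  have he0 : e ≠ 0 := by rw [← norm_ne_zero_iff, he]; exact one_ne_zero
  have hinj : Function.Injective x := nfv_cfg_injective he0 ht
  have h01 : x 0 ≠ x 1 := fun h => absurd (hinj h) (by decide)
  have h := bump_le_twoPt_sq hΔ.le h01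
  have hdiff : x 0 - x 1 = (t - 1) • e := by
    simp only [hx, Matrix.cons_val_zero, Matrix.cons_val_one]
    rw [sub_smul, one_smul]
  have hnorm : ‖x 0 - x 1‖ = t - 1 := by
    rw [hdiff, nfv_norm_smul he (by linarith)]
  rw [twoPt, hnorm] at h
  exact h

/-- **The barrier witness has no vertex measure (D-0021 barrier evasion of line `Sketch`).** For
`0 < Δ`, the sharpened witness `ScaleNotMoebius.narrowFamily Δ` of
`Literature.Barriers.CriticalPhenomena.ScaleCovarianceNotMoebius` (Euclidean and scale covariant,
two-point function `‖x − y‖^{-2Δ}`, not Möbius covariant) admits NO representation of its connected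
four-point function as `U₄(x₁; x₂,x₃,x₄) = −∫ ‖x₁ − z‖^{-2Δ} dν(z)` with `ν = ν_{x₂,x₃,x₄}` a finite
positive measure: `U₄ = −bump` decays like `‖x₁‖^{-4Δ}` in `x₁`, faster than the potential
`∫ ‖x₁ − z‖^{-2Δ} dν(z) ≳ ν(B_R) ‖x₁‖^{-2Δ}` of any non-zero finite positive measure, while
`bump > 0` excludes `ν = 0`. Tested on the triple `(e, 2e, 3e)` and `x₁ = t e`, `t → ∞`. -/
theorem stub_narrowFamilyNoVertexMeasure :
    ∀ Δ : ℝ, 0 < Δ →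
      ¬ ∀ x₂ x₃ x₄ : EuclideanSpace ℝ (Fin 3), ∃ ν : Measure (EuclideanSpace ℝ (Fin 3)),
          IsFiniteMeasure ν ∧
            ∀ x₁ : EuclideanSpace ℝ (Fin 3),
              (![x₁, x₂, x₃, x₄] : Fin 4 → EuclideanSpace ℝ (Fin 3)) ∈ NonCoincident 3 4 →
                Integrable (fun z => (1 : ℝ) * ‖x₁ - z‖ ^ (-(2 * Δ))) ν ∧
                  limitConnectedFour (Literature.Barriers.CriticalPhenomena.ScaleNotMoebius.narrowFamily Δ)
                      ![x₁, x₂, x₃, x₄] =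
                    -∫ z, (1 : ℝ) * ‖x₁ - z‖ ^ (-(2 * Δ)) ∂ν := by
  intro Δ hΔ hV
  -- a unit vector `e0`
  obtain ⟨e0, he0⟩ : ∃ e : EuclideanSpace ℝ (Fin 3), ‖e‖ = 1 :=
    ⟨EuclideanSpace.single 0 1, by simp⟩
  have he0' : e0 ≠ 0 := by rw [← norm_ne_zero_iff, he0]; exact one_ne_zero
  obtain ⟨ν, hfin, hrep⟩ := hV e0 ((2 : ℝ) • e0) ((3 : ℝ) • e0)
  -- the representation read along the test configuration `(t e0, e0, 2 e0, 3 e0)`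
  have hbump : ∀ t : ℝ, 3 < t →
      Integrable (fun z => ‖t • e0 - z‖ ^ (-(2 * Δ))) ν ∧
        bump Δ ![t • e0, e0, (2 : ℝ) • e0, (3 : ℝ) • e0] = ∫ z, ‖t • e0 - z‖ ^ (-(2 * Δ)) ∂ν := by
    intro t ht
    have hx : (![t • e0, e0, (2 : ℝ) • e0, (3 : ℝ) • e0] : Fin 4 → EuclideanSpace ℝ (Fin 3)) ∈
        NonCoincident 3 4 :=
      (mem_nonCoincident _).2 (nfv_cfg_injective he0' ht)
    obtain ⟨hint, hEq⟩ := hrep (t • e0) hx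
    rw [limitConnectedFour_narrowFamily Δ (nfv_cfg_injective he0' ht)] at hEq
    simp only [one_mul] at hint hEq
    exact ⟨hint, by linarith⟩
  by_cases hν : ν = 0
  · -- `ν = 0` contradicts `bump > 0`
    obtain ⟨-, hb⟩ := hbump 4 (by norm_num)
    rw [hν, integral_zero_measure] at hb
    exact absurd hb (bump_pos Δ (nfv_cfg_injective he0' (by norm_num : (3 : ℝ) < 4))).ne'
  · -- a ball of positive mass
    have huniv : ν Set.univ ≠ 0 := by rwa [Ne, Measure.measure_univ_eq_zero]
    obtain ⟨R, hR⟩ : ∃ R : ℕ, 0 < ν (closedBall (0 : EuclideanSpace ℝ (Fin 3)) R) := by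
      by_contra hcon
      push Not at hcon
      have h0 : ∀ n : ℕ, ν (closedBall (0 : EuclideanSpace ℝ (Fin 3)) n) = 0 := fun n =>
        nonpos_iff_eq_zero.1 (hcon n)
      have hU : (Set.univ : Set (EuclideanSpace ℝ (Fin 3))) =
          ⋃ n : ℕ, closedBall (0 : EuclideanSpace ℝ (Fin 3)) n := by
        ext z
        simp only [Set.mem_univ, Set.mem_iUnion, mem_closedBall, dist_zero_right, true_iff]
        exact exists_nat_ge ‖z‖
      exact huniv (by rw [hU]; exact measure_iUnion_null h0)
    set m : ℝ := (ν (closedBall (0 : EuclideanSpace ℝ (Fin 3)) R)).toReal with hm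
    have hmpos : 0 < m := ENNReal.toReal_pos hR.ne' (measure_ne_top ν _)
    have hRnn : (0 : ℝ) ≤ R := Nat.cast_nonneg R
    -- monopole lower bound along the test configuration, for `t ≥ R + 1`
    have hlow : ∀ t : ℝ, (R : ℝ) + 1 ≤ t → 3 < t →
        m * (t + R) ^ (-(2 * Δ)) ≤ bump Δ ![t • e0, e0, (2 : ℝ) • e0, (3 : ℝ) • e0] := by
      intro t hRt ht
      obtain ⟨hint, hb⟩ := hbump t ht
      have htpos : 0 < t := by linarith
      have hball : ∀ z ∈ closedBall (0 : EuclideanSpace ℝ (Fin 3)) R,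
          (t + R) ^ (-(2 * Δ)) ≤ ‖t • e0 - z‖ ^ (-(2 * Δ)) := by
        intro z hz
        rw [mem_closedBall, dist_zero_right] at hz
        have hte : ‖t • e0‖ = t := nfv_norm_smul he0 htpos
        have hpos : 0 < ‖t • e0 - z‖ := by
          have h1 := norm_sub_norm_le (t • e0) z
          rw [hte] at h1
          linarith
        have hle : ‖t • e0 - z‖ ≤ t + R := by
          calc ‖t • e0 - z‖ ≤ ‖t • e0‖ + ‖z‖ := norm_sub_le _ _
            _ ≤ t + R := by rw [hte]; linarith
        exact Real.rpow_le_rpow_of_nonpos hpos hle (by linarith)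
      have hconst : IntegrableOn (fun _ : EuclideanSpace ℝ (Fin 3) => (t + R) ^ (-(2 * Δ)))
          (closedBall (0 : EuclideanSpace ℝ (Fin 3)) R) ν :=
        integrableOn_const
      have hstep1 : m * (t + R) ^ (-(2 * Δ)) =
          ∫ _ in closedBall (0 : EuclideanSpace ℝ (Fin 3)) R, (t + R) ^ (-(2 * Δ)) ∂ν := by
        rw [setIntegral_const, smul_eq_mul, hm, measureReal_def]
      rw [hb, hstep1]
      calc ∫ _ in closedBall (0 : EuclideanSpace ℝ (Fin 3)) R, (t + R) ^ (-(2 * Δ)) ∂ν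
          ≤ ∫ z in closedBall (0 : EuclideanSpace ℝ (Fin 3)) R, ‖t • e0 - z‖ ^ (-(2 * Δ)) ∂ν :=
            setIntegral_mono_on hconst hint.integrableOn measurableSet_closedBall hball
        _ ≤ ∫ z, ‖t • e0 - z‖ ^ (-(2 * Δ)) ∂ν :=
            setIntegral_le_integral hint
              (Eventually.of_forall fun z => Real.rpow_nonneg (norm_nonneg _) _)
    -- crude comparisons for `t ≥ 2R + 4`: `m 2^{-2Δ} ≤ 2^{4Δ} t^{-2Δ}`
    have key : ∀ t : ℝ, 2 * (R : ℝ) + 4 ≤ t →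
        m * (2 : ℝ) ^ (-(2 * Δ)) ≤ (2 : ℝ) ^ (4 * Δ) * t ^ (-(2 * Δ)) := by
      intro t hRt
      have ht3 : (3 : ℝ) < t := by linarith
      have htpos : 0 < t := by linarith
      have h1 := hlow t (by linarith) ht3
      have h2 := nfv_bump_cfg_le he0 hΔ ht3
      -- `(t+R)^{-2Δ} ≥ (2t)^{-2Δ} = 2^{-2Δ} t^{-2Δ}`
      have hA : (2 * t) ^ (-(2 * Δ)) ≤ (t + R) ^ (-(2 * Δ)) :=
        Real.rpow_le_rpow_of_nonpos (by linarith) (by linarith) (by linarith)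
      have hA' : (2 * t) ^ (-(2 * Δ)) = (2 : ℝ) ^ (-(2 * Δ)) * t ^ (-(2 * Δ)) :=
        Real.mul_rpow (by norm_num) htpos.le
      -- `(t-1)^{-2Δ} ≤ (t/2)^{-2Δ} = 2^{2Δ} t^{-2Δ}`
      have hB : (t - 1) ^ (-(2 * Δ)) ≤ (t / 2) ^ (-(2 * Δ)) :=
        Real.rpow_le_rpow_of_nonpos (by linarith) (by linarith) (by linarith)
      have hB' : (t / 2) ^ (-(2 * Δ)) = (2 : ℝ) ^ (2 * Δ) * t ^ (-(2 * Δ)) := by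
        rw [Real.div_rpow htpos.le (by norm_num), Real.rpow_neg (by norm_num : (0 : ℝ) ≤ 2),
          div_inv_eq_mul, mul_comm]
      have hBnn : 0 ≤ (t - 1) ^ (-(2 * Δ)) := Real.rpow_nonneg (by linarith) _
      have hB2 : ((t - 1) ^ (-(2 * Δ))) ^ 2 ≤ ((2 : ℝ) ^ (2 * Δ) * t ^ (-(2 * Δ))) ^ 2 := by
        rw [← hB']; exact pow_le_pow_left₀ hBnn hB 2
      have hsq : ((2 : ℝ) ^ (2 * Δ) * t ^ (-(2 * Δ))) ^ 2 =
          (2 : ℝ) ^ (4 * Δ) * (t ^ (-(2 * Δ)) * t ^ (-(2 * Δ))) := by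
        have : ((2 : ℝ) ^ (2 * Δ)) ^ 2 = (2 : ℝ) ^ (4 * Δ) := by
          rw [← Real.rpow_natCast, ← Real.rpow_mul (by norm_num : (0 : ℝ) ≤ 2)]; norm_num; ring_nf
        rw [mul_pow, this, pow_two]
      -- chain: `m 2^{-2Δ} t^{-2Δ} ≤ m (t+R)^{-2Δ} ≤ bump ≤ ((t-1)^{-2Δ})² ≤ 2^{4Δ} t^{-2Δ} t^{-2Δ}`
      have hchain : m * ((2 : ℝ) ^ (-(2 * Δ)) * t ^ (-(2 * Δ))) ≤
          (2 : ℝ) ^ (4 * Δ) * (t ^ (-(2 * Δ)) * t ^ (-(2 * Δ))) := by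
        calc m * ((2 : ℝ) ^ (-(2 * Δ)) * t ^ (-(2 * Δ))) = m * (2 * t) ^ (-(2 * Δ)) := by rw [hA']
          _ ≤ m * (t + R) ^ (-(2 * Δ)) := mul_le_mul_of_nonneg_left hA hmpos.le
          _ ≤ bump Δ ![t • e0, e0, (2 : ℝ) • e0, (3 : ℝ) • e0] := h1
          _ ≤ ((t - 1) ^ (-(2 * Δ))) ^ 2 := h2
          _ ≤ ((2 : ℝ) ^ (2 * Δ) * t ^ (-(2 * Δ))) ^ 2 := hB2
          _ = (2 : ℝ) ^ (4 * Δ) * (t ^ (-(2 * Δ)) * t ^ (-(2 * Δ))) := hsq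
      have htp : 0 < t ^ (-(2 * Δ)) := Real.rpow_pos_of_pos htpos _
      -- divide by `t^{-2Δ}`
      have := hchain
      rw [← mul_assoc, ← mul_assoc] at this
      exact le_of_mul_le_mul_right this htp
    -- choose `t` so large that `2^{4Δ} t^{-2Δ} < m 2^{-2Δ}`
    set a : ℝ := (2 : ℝ) ^ (6 * Δ) / m + 1 with ha
    have hapos : 0 < a := by positivity
    set u : ℝ := a ^ (1 / (2 * Δ)) with hu
    have hupos : 0 < u := Real.rpow_pos_of_pos hapos _
    set t : ℝ := max (2 * (R : ℝ) + 4) (u + 1) with htdef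
    have ht1 : 2 * (R : ℝ) + 4 ≤ t := le_max_left _ _
    have ht2 : u < t := lt_of_lt_of_le (by linarith) (le_max_right _ _)
    have htpos : 0 < t := by linarith
    have h2Δ : 0 < 2 * Δ := by linarith
    -- `t^{2Δ} > a`
    have hta : a < t ^ (2 * Δ) := by
      have h := Real.rpow_lt_rpow hupos.le ht2 h2Δ
      have hua : u ^ (2 * Δ) = a := by
        rw [hu, ← Real.rpow_mul hapos.le, one_div, inv_mul_cancel₀ h2Δ.ne', Real.rpow_one]
      rwa [hua] at h
    -- hence `t^{-2Δ} < m 2^{-6Δ}`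
    have htneg : t ^ (-(2 * Δ)) < m * (2 : ℝ) ^ (-(6 * Δ)) := by
      rw [Real.rpow_neg htpos.le, Real.rpow_neg (by norm_num : (0 : ℝ) ≤ 2)]
      have hq : (2 : ℝ) ^ (6 * Δ) / m < t ^ (2 * Δ) := by linarith
      have h6 : 0 < (2 : ℝ) ^ (6 * Δ) := Real.rpow_pos_of_pos (by norm_num) _
      rw [div_lt_iff₀ hmpos] at hq
      rw [inv_lt_iff_one_lt_mul₀ (Real.rpow_pos_of_pos htpos _)]
      calc (1 : ℝ) = (2 : ℝ) ^ (6 * Δ) * ((2 : ℝ) ^ (6 * Δ))⁻¹ := by rw [mul_inv_cancel₀ h6.ne']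
        _ < t ^ (2 * Δ) * m * ((2 : ℝ) ^ (6 * Δ))⁻¹ := by
            apply mul_lt_mul_of_pos_right hq (inv_pos.2 h6)
        _ = m * ((2 : ℝ) ^ (6 * Δ))⁻¹ * t ^ (2 * Δ) := by ring
    have hk := key t ht1
    -- combine: `m 2^{-2Δ} ≤ 2^{4Δ} t^{-2Δ} < 2^{4Δ} m 2^{-6Δ} = m 2^{-2Δ}`
    have h4 : 0 < (2 : ℝ) ^ (4 * Δ) := Real.rpow_pos_of_pos (by norm_num) _
    have hlt : (2 : ℝ) ^ (4 * Δ) * t ^ (-(2 * Δ)) < (2 : ℝ) ^ (4 * Δ) * (m * (2 : ℝ) ^ (-(6 * Δ))) :=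
      mul_lt_mul_of_pos_left htneg h4
    have heq : (2 : ℝ) ^ (4 * Δ) * (m * (2 : ℝ) ^ (-(6 * Δ))) = m * (2 : ℝ) ^ (-(2 * Δ)) := by
      have : (2 : ℝ) ^ (4 * Δ) * (2 : ℝ) ^ (-(6 * Δ)) = (2 : ℝ) ^ (-(2 * Δ)) := by
        rw [← Real.rpow_add (by norm_num : (0 : ℝ) < 2)]; ring_nf
      calc (2 : ℝ) ^ (4 * Δ) * (m * (2 : ℝ) ^ (-(6 * Δ)))
          = m * ((2 : ℝ) ^ (4 * Δ) * (2 : ℝ) ^ (-(6 * Δ))) := by ring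
        _ = m * (2 : ℝ) ^ (-(2 * Δ)) := by rw [this]
    linarith

end BarrierEvasion

end Summit.CriticalPhenomena.Ising3DConformalLimit.PrecisionLaplacianMoebiusLimitOfTwoPointLaw

end
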